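import Summits.RiemannHypothesis.RiemannHypothesis.Theorems.WeilFormatCDataKitCBM
import Summits.RiemannHypothesis.RiemannHypothesis.Theorems.WeilFormatCWindowMarginSector
import HarnessLib

/-!
# Format C: the ODD-SECTOR λ-DOOR — `2·λ ≤ ε_od(a) = weilOddGroundEnergy a` from a shifted odd kernel certificate

Helper file (`--supports stmt-RiemannHypothesis-18085`, the parity ladder / `NoParityCrossing`), RH-free, no
definitions, no named facts.  Prover A (g22 of unit `sr-gb-rung-a`, route GroundBarta; re-creation of the g21 staged
file, which was lost with that seat's folder), on the lead's ruling R17-4⁗ (2) / R17-5 (5): the L-side of every parity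
cell `(b, c]` beyond `83/100` is an ODD-sector format-C certificate `L ≤ ε_od(c)` with `L > U(b) ≥ ε(b)`, consumed by
`EvenWinsBeyondArch.weilWindowSimpleEven_upTo_step` (`WeilParityEvenWinsBeyondArchLadderStep.lean`).

* §1 `le_weilOddGroundEnergy_of_formatC_oddPiecesA` — the ODD HALF of weil-10/weil-1's three-piece door
  `weilPositivityOn_of_formatC_piecesA` VERBATIM (same `hPA`/`A`, blocks `Bo ≤ B3o ≤ B4o`, weights, `Umido`, `U2o`),
  with exactly these edits: the far-diagonal floors `h0o`, `hd0o.2`, `hwo … .2`, `hwmo … .2` each get a trailing `− lam`;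
  the kernel PSD premise `hSo` is on the SHIFTED odd kernel `M⁻(k,k') − [k = k']·lam` (the exact columns, the middle and
  the tail are off-diagonal: unchanged); NO even-sector data; conclusion `2 * lam ≤ weilOddGroundEnergy a` through
  A g21's sector margin dictionary `le_weilOddGroundEnergy_of_shifted_odd_kernel_nonneg` (p396493).
* §2 `le_weilOddGroundEnergy_of_kitCBM_odd` — the PRODUCTION-KIT twin: the ODD HALF of weil-2's
  `weilPositivityOn_of_kitCBM` (p340651 lineage, the kit that proved `WeilFormatCData.A1.weilPositivityOn_one`) composed
  with §1.  Same odd kit hypotheses (`hCTo`, `hsqo`, `h0o`, `hd0o`, `hWo`, `hUmO`, `hU2O`, `hfaco`) EXCEPT: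
  `hF : FDValidA S a (A + 2·lam) F` (the front-door record's `Aop` box encloses `A + 2λ`, so every far-side kit check —
  floors, reciprocal column weights, tail floor — is automatically against `d̂ − λ`), the Schur bands `hSo` are the
  LOWER-triangle predicate the generated `…SchurB*` files chain (`SchurNearG … DSo true Bo`, UNshifted claimed integers
  `DSo`, verbatim as today), plus `hDS : getMZ DSo' k k' = getMZ DSo k k' − [k = k']·lamZ` and the kernel PSD check
  `hPo : checkPsdMid Bo δo ρo DSo' Lo = true` on the SHIFTED midpoints; `lam := lamZ · 2^{−co}` (the Schur unit);
  conclusion `2 * (lamZ · 2^{−co}) ≤ weilOddGroundEnergy a`.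

Emitter contract (weil-2 g17, rh-explicit INBOX l.6702/6738): to certify `μ ≤ ε_od(c)` run the ODD sector at `a = c`
with `lam = μ/2`, `F.Aop ∋ A + μ`, Schur bands unchanged, `DSo' = DSo − lamZ·I`, LDLᵀ of `DSo'`.  First target: cell 8,
`c = 173/200`, `μ = 2^-60 > U(83/100) = 483/10^21` (`hPA` = a `primeCoeff_form_ge_cells_*` constant valid at `173/200`).

The two shift identities `sum_sum_mul_shift_mul` / `sum_sum_mul_mul_shift` live in `WeilFormatCWindowMarginSector` §5.

Standard axioms; nothing is defined; no RH claim.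
-/

set_option linter.dupNamespace false
set_option autoImplicit false

noncomputable section

open Complex Finset Matrix
open scoped Real BigOperators ComplexConjugate ArithmeticFunction.vonMangoldt

namespace Summit.RiemannHypothesis.RiemannHypothesis.Theorems.WeilFormatC

open Literature.NumberTheory.LFunctions Literature.NumberTheory.LFunctions.Yoshida1992
  Literature.NumberTheory.LFunctions.Yoshida1992.Encl Literature.Analysis.SpecialFunctions
  Literature.Analysis.ValidatedNumerics.NumericsMP

variable {a : ℝ}

/-! ## §1 The odd-sector λ-door (three pieces, certified prime constant) -/

section Door

/-- **The ODD-sector λ-door, format C (three pieces, certified prime constant `A`).**  The odd half of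
`weilPositivityOn_of_formatC_piecesA` with the far-diagonal floors lowered by `lam` and the kernel PSD check on the
shifted odd kernel `M⁻ − lam·1`; conclusion `2·lam ≤ weilOddGroundEnergy a` (the orthonormal odd basis
`(χ_{k+1} − χ_{−k−1})/√2` has kernel `2M⁻`).  See the module docstring. [folklore] -/
theorem le_weilOddGroundEnergy_of_formatC_oddPiecesA (ha : 0 < a)
    -- the certified PRIME constant of the window (`primeCoeff_form_ge_cells_*`, or `A_op⁺` via `primeCoeff_form_ge`)
    {A : ℝ} (hPA : ∀ (s : Finset ℤ) (c : ℤ → ℂ),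
      -(A * ∑ n ∈ s, ‖c n‖ ^ 2) ≤ ∑ n ∈ s, ∑ m ∈ s, (conj (c n) * c m).re * primeCoeff a n m)
    -- the shift (`lam = μ/2` for the target `μ ≤ ε_od(a)`)
    (lam : ℝ)
    -- ODD sector data
    {Bo B3o B4o : ℕ} (hBo : 1 ≤ Bo) (hBBo : Bo ≤ B3o) (hB34o : B3o ≤ B4o) {d0o : ℝ}
    (wo wmo : ℕ → ℝ)
    (h0o : 0 < ((reDigammaQuarter (freq a ((Bo : ℤ) + 1)) - Real.log π) / 2 - 1 / (8 * ((Bo : ℝ) + 1)) - a * (1 + weilArchDensity (2 * a)) / (π ^ 2 * ((Bo : ℝ) + 1) ^ 2)) - π / 4 - a * (1 + weilArchDensity (2 * a)) / π ^ 2 * Real.sqrt (8 / Bo) - A / 2 - (Real.exp (a / 2) - Real.exp (-(a / 2))) ^ 2 * a / (π ^ 2 * Bo) - lam)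
    (hd0o : 0 < d0o ∧ d0o ≤ ((reDigammaQuarter (freq a ((B4o : ℤ) + 1)) - Real.log π) / 2 - 1 / (8 * ((B4o : ℝ) + 1)) - a * (1 + weilArchDensity (2 * a)) / (π ^ 2 * ((B4o : ℝ) + 1) ^ 2)) - π / 4 - a * (1 + weilArchDensity (2 * a)) / π ^ 2 * Real.sqrt (8 / Bo) - A / 2 - (Real.exp (a / 2) - Real.exp (-(a / 2))) ^ 2 * a / (π ^ 2 * Bo) - lam)
    (hwo : ∀ l, Bo ≤ l → l < B3o → 0 < wo l ∧ wo l ≤ ((reDigammaQuarter (freq a ((l : ℤ) + 1)) - Real.log π) / 2 - 1 / (8 * ((l : ℝ) + 1)) - a * (1 + weilArchDensity (2 * a)) / (π ^ 2 * ((l : ℝ) + 1) ^ 2) - (π / 2 - Real.arctan (Real.sqrt Bo / Real.sqrt ((l : ℝ) + 1))) / 2 - a * (1 + weilArchDensity (2 * a)) / π ^ 2 * Real.sqrt (8 / Bo) - A / 2 - (Real.exp (a / 2) - Real.exp (-(a / 2))) ^ 2 * a / (π ^ 2 * Bo)) - lam)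
    (hwmo : ∀ l, B3o ≤ l → l < B4o → 0 < wmo l ∧ wmo l ≤ ((reDigammaQuarter (freq a ((l : ℤ) + 1)) - Real.log π) / 2 - 1 / (8 * ((l : ℝ) + 1)) - a * (1 + weilArchDensity (2 * a)) / (π ^ 2 * ((l : ℝ) + 1) ^ 2) - (π / 2 - Real.arctan (Real.sqrt Bo / Real.sqrt ((l : ℝ) + 1))) / 2 - a * (1 + weilArchDensity (2 * a)) / π ^ 2 * Real.sqrt (8 / Bo) - A / 2 - (Real.exp (a / 2) - Real.exp (-(a / 2))) ^ 2 * a / (π ^ 2 * Bo)) - lam)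
    (Umido : Matrix (Fin Bo) (Fin Bo) ℝ)
    (hUmido : ∀ d : ℕ → ℝ, (∀ l, B3o ≤ l → l < B4o → 0 < wmo l ∧ wmo l ≤ d l) → ∀ x : Fin Bo → ℝ,
      ∑ l ∈ Finset.Ico B3o B4o, (∑ k : Fin Bo, ((gramCoeff a (((k : ℕ) : ℤ) + 1) ((l : ℤ) + 1) - gramCoeff a (((k : ℕ) : ℤ) + 1) (-((l : ℤ) + 1))) / 2) * x k) ^ 2 / d l
        ≤ x ⬝ᵥ Umido *ᵥ x)
    (U2o : Matrix (Fin Bo) (Fin Bo) ℝ)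
    (hU2o : ∀ d : ℕ → ℝ, (∀ l, B4o ≤ l → d0o ≤ d l) → ∀ (N : ℕ) (x : Fin Bo → ℝ),
      ∑ l ∈ Finset.Ico B4o N, (∑ k : Fin Bo, ((gramCoeff a (((k : ℕ) : ℤ) + 1) ((l : ℤ) + 1) - gramCoeff a (((k : ℕ) : ℤ) + 1) (-((l : ℤ) + 1))) / 2) * x k) ^ 2 / d l
        ≤ x ⬝ᵥ U2o *ᵥ x)
    (hSo : ∀ x : Fin Bo → ℝ, 0 ≤ ∑ k, ∑ k', x k * x k' *
      ((((gramCoeff a (((k : ℕ) : ℤ) + 1) (((k' : ℕ) : ℤ) + 1) - gramCoeff a (((k : ℕ) : ℤ) + 1) (-(((k' : ℕ) : ℤ) + 1))) / 2)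
          - (if (k : ℕ) = k' then lam else 0))
        - (∑ l ∈ Finset.Ico Bo B3o, ((gramCoeff a (((k : ℕ) : ℤ) + 1) ((l : ℤ) + 1) - gramCoeff a (((k : ℕ) : ℤ) + 1) (-((l : ℤ) + 1))) / 2) * ((gramCoeff a (((k' : ℕ) : ℤ) + 1) ((l : ℤ) + 1) - gramCoeff a (((k' : ℕ) : ℤ) + 1) (-((l : ℤ) + 1))) / 2) / wo l)
        - Umido k k' - U2o k k')) :
    2 * lam ≤ weilOddGroundEnergy a := by
  have hE0 : 0 < weilArchDensity (2 * a) := weilArchDensity_pos (by positivity)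
  have hC : 0 ≤ a * (1 + weilArchDensity (2 * a)) := by positivity
  -- the odd sector kernel, its shift, the far diagonal and its shift
  set Mod : ℕ → ℕ → ℝ := fun k l ↦ ((gramCoeff a ((k : ℤ) + 1) ((l : ℤ) + 1) - gramCoeff a ((k : ℤ) + 1) (-((l : ℤ) + 1))) / 2) with hMod
  set Mod' : ℕ → ℕ → ℝ := fun k l ↦ Mod k l - (if k = l then lam else 0) with hMod'
  set dod : ℕ → ℝ := fun l ↦ ((reDigammaQuarter (freq a ((l : ℤ) + 1)) - Real.log π) / 2 - 1 / (8 * ((l : ℝ) + 1)) - a * (1 + weilArchDensity (2 * a)) / (π ^ 2 * ((l : ℝ) + 1) ^ 2) - (π / 2 - Real.arctan (Real.sqrt Bo / Real.sqrt ((l : ℝ) + 1))) / 2 - a * (1 + weilArchDensity (2 * a)) / π ^ 2 * Real.sqrt (8 / Bo) - A / 2 - (Real.exp (a / 2) - Real.exp (-(a / 2))) ^ 2 * a / (π ^ 2 * Bo)) with hdod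
  set dod' : ℕ → ℝ := fun l ↦ dod l - lam with hdod'
  have hsymm : ∀ k l, Mod k l = Mod l k := fun k l ↦
    oddKernel_symm (gramCoeff a) (gramCoeff_comm a) (gramCoeff_neg_neg a) k l
  have hsymm' : ∀ k l, Mod' k l = Mod' l k := fun k l ↦ by
    simp only [hMod']
    rw [hsymm k l]
    by_cases h : k = l
    · subst h; rfl
    · rw [if_neg h, if_neg (Ne.symm h)]
  -- off the diagonal the shift is invisible: rows `k < Bo`, columns `l ≥ Bo`
  have hoff : ∀ (k : Fin Bo) (l : ℕ), Bo ≤ l → Mod' k l = Mod k l := fun k l hl ↦ by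
    have hk := k.isLt
    simp only [hMod']
    rw [if_neg (by omega), sub_zero]
  refine le_weilOddGroundEnergy_of_shifted_odd_kernel_nonneg ha (gramCoeff a) (weilWindowSesq_chi ha)
    (gramCoeff_neg_neg a) fun K z ↦ ?_
  have hB3o : 1 ≤ B3o := by omega
  have hd : ∀ l, Bo ≤ l → 0 < dod' l := fun l hl ↦ by
    simp only [hdod', hdod]
    have h := odd_dhat_core_mono ha hC hl
    have hpen := hilbert_atan_penalty_le Bo l
    linarith [h0o]
  have hdlow : ∀ l, B4o ≤ l → d0o ≤ dod' l := fun l hl ↦ by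
    simp only [hdod', hdod]
    have h := odd_dhat_core_mono ha hC hl
    have hpen := hilbert_atan_penalty_le Bo l
    linarith [hd0o.2]
  have hfar : ∀ (N : ℕ) (z : ℕ → ℝ),
      ∑ k ∈ Finset.Ico Bo N, dod' k * z k ^ 2 ≤ ∑ k ∈ Finset.Ico Bo N, ∑ l ∈ Finset.Ico Bo N, z k * Mod' k l * z l :=
    fun N z ↦ by
      have h0 : ∑ k ∈ Finset.Ico Bo N, dod k * z k ^ 2 ≤ ∑ k ∈ Finset.Ico Bo N, ∑ l ∈ Finset.Ico Bo N, z k * Mod k l * z l := by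
        simp only [hdod, hMod]
        exact gramCoeff_odd_far_ge_diag_atan_A ha hPA hBo N z
      have e1 : ∑ k ∈ Finset.Ico Bo N, dod' k * z k ^ 2 = (∑ k ∈ Finset.Ico Bo N, dod k * z k ^ 2) - lam * ∑ k ∈ Finset.Ico Bo N, z k ^ 2 := by
        simp only [hdod', sub_mul, Finset.sum_sub_distrib, Finset.mul_sum]
      rw [e1, sum_sum_mul_shift_mul (Finset.Ico Bo N) Mod lam z]
      linarith
  have hU1 : ∀ x : Fin Bo → ℝ,
      ∑ l ∈ Finset.Ico Bo B3o, (∑ k : Fin Bo, Mod' k l * x k) ^ 2 / dod' l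
        ≤ x ⬝ᵥ (Matrix.of fun k k' : Fin Bo ↦ ∑ l ∈ Finset.Ico Bo B3o, Mod k l * Mod k' l / wo l) *ᵥ x := fun x ↦ by
    have h := columns_majorant (Finset.Ico Bo B3o) (fun l k ↦ Mod k l) dod' wo
      (fun l hl ↦ by
        have hl := Finset.mem_Ico.mp hl
        have h := hwo l hl.1 hl.2
        simp only [hdod', hdod]
        exact h) x
    refine le_of_eq_of_le (Finset.sum_congr rfl fun l hl ↦ ?_) h
    rw [Finset.sum_congr rfl fun k _ ↦ by rw [hoff k l (Finset.mem_Ico.mp hl).1]]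
  have hmid : ∀ x : Fin Bo → ℝ,
      ∑ l ∈ Finset.Ico B3o B4o, (∑ k : Fin Bo, Mod' k l * x k) ^ 2 / dod' l ≤ x ⬝ᵥ Umido *ᵥ x := fun x ↦ by
    have h := hUmido dod' (fun l hl hl' ↦ by
      have h := hwmo l hl hl'
      simp only [hdod', hdod]
      exact h) x
    refine le_of_eq_of_le (Finset.sum_congr rfl fun l hl ↦ ?_) (by simpa only [hMod, hdod', hdod] using h)
    rw [Finset.sum_congr rfl fun k _ ↦ by rw [hoff k l (by have := (Finset.mem_Ico.mp hl).1; omega)]]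
  have htail : ∀ (N : ℕ) (x : Fin Bo → ℝ),
      ∑ l ∈ Finset.Ico B4o N, (∑ k : Fin Bo, Mod' k l * x k) ^ 2 / dod' l ≤ x ⬝ᵥ U2o *ᵥ x := fun N x ↦ by
    have h := hU2o dod' hdlow N x
    refine le_of_eq_of_le (Finset.sum_congr rfl fun l hl ↦ ?_) (by simpa only [hMod, hdod', hdod] using h)
    rw [Finset.sum_congr rfl fun k _ ↦ by rw [hoff k l (by have := (Finset.mem_Ico.mp hl).1; omega)]]
  have hU2 : ∀ (N : ℕ) (x : Fin Bo → ℝ),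
      ∑ l ∈ Finset.Ico B3o N, (∑ k : Fin Bo, Mod' k l * x k) ^ 2 / dod' l ≤ x ⬝ᵥ (Umido + U2o) *ᵥ x := by
    intro N x
    have hnn : ∀ l, B3o ≤ l → 0 ≤ (∑ k : Fin Bo, Mod' k l * x k) ^ 2 / dod' l := fun l hl ↦
      div_nonneg (sq_nonneg _) (hd l (by omega)).le
    rw [Matrix.add_mulVec, dotProduct_add]
    refine le_trans ?_ (add_le_add (hmid x) (htail N x))
    exact sum_Ico_le_sum_Ico_add_sum_Ico hB34o hnn
  have key := sum_range_mul_mul_nonneg_of_certificate_sum_split Mod' hsymm' Bo B3o hBBo dod' _ _ hd hfar hU1 hU2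
    (fun x ↦ by
      refine (hSo x).trans_eq (Finset.sum_congr rfl fun k _ ↦ Finset.sum_congr rfl fun k' _ ↦ ?_)
      simp only [hMod', hMod, Matrix.of_apply, Matrix.add_apply]
      ring) K z
  simpa only [hMod', hMod] using key

end Door

/-! ## §2 The production-kit twin (weil-2's column-band kit `CBM`, odd half, shifted midpoints as a second table) -/

section Kit

variable {S : ℕ} {ks : List PrimeLen} {C : Consts} {F : FDConsts}

/-- **`2·λ ≤ weilOddGroundEnergy a` from the column-band data kit, ODD sector only.**  The odd half of
`weilPositivityOn_of_kitCBM` through §1: `hF` encloses `A + 2·lam` (`lam := lamZ · 2^{−co}`), the Schur bands `hSo`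
are the lower-triangle predicate against the UNshifted claimed integers `DSo` (verbatim what the generated band files
prove), `hDS` relates the shifted table `DSo' = DSo − lamZ·I`, and `hPo` is the kernel PSD check of `DSo'`;
`hUsym` is the symmetry of the subtracted middle+tail (for the symmetric completion of the bands). -/
theorem le_weilOddGroundEnergy_of_kitCBM_odd (ha : 0 < a)
    {A : ℝ} (hPA : ∀ (s : Finset ℤ) (c : ℤ → ℂ),
      -(A * ∑ n ∈ s, ‖c n‖ ^ 2) ≤ ∑ n ∈ s, ∑ m ∈ s, (conj (c n) * c m).re * primeCoeff a n m)
    {lamZ : ℤ} {co : ℕ}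
    (hS : 0 < S) (hC : ConstsValid S a ks C) (hF : FDValidA S a (A + 2 * ((lamZ : ℝ) * (1 / 2 ^ co))) F)
    {Bo Ko Kpo B3o B4o : ℕ} (hBo : 1 ≤ Bo) (hKo : Bo + Ko = B3o) (hKpo : Bo + Kpo = B4o) (hKKo : Ko ≤ Kpo)
    {ctabO : List IdxRec} (hCTo : TabColValid S a ks Bo (B4o + 2) ctabO)
    {cdo d0zo po qo Ksero qr : ℕ} {rso : List ℕ} (hd0zo : 0 < d0zo) (hsqo : checkSqrtUpper 8 Bo po qo = true)
    (h0o : 0 < (devOddBox S C F (tget ctabO (Bo + 1)) Bo Bo po qo).lo)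
    (hd0o : (d0zo : ℤ) * (S : ℤ) ≤ (devOddBox S C F (tget ctabO (B4o + 1)) B4o Bo po qo).lo * 2 ^ cdo)
    {cvo : ℕ} {vo : List ℕ} (hWo : checkWeightsOddV S Ksero C F ctabO Bo Kpo cvo vo rso qr po qo = true)
    (UmO : ℕ → ℕ → ℝ)
    (hUmO : ∀ d : ℕ → ℝ, (∀ l, B3o ≤ l → l < B4o → 0 < wvF vo cvo Bo l ∧ wvF vo cvo Bo l ≤ d l) → ∀ x : Fin Bo → ℝ,
      ∑ l ∈ Finset.Ico B3o B4o, (∑ k : Fin Bo, ((gramCoeff a (((k : ℕ) : ℤ) + 1) ((l : ℤ) + 1)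
        - gramCoeff a (((k : ℕ) : ℤ) + 1) (-((l : ℤ) + 1))) / 2) * x k) ^ 2 / d l
        ≤ x ⬝ᵥ (Matrix.of fun k k' : Fin Bo ↦ UmO k k') *ᵥ x)
    (U2O : ℕ → ℕ → ℝ)
    (hU2O : ∀ d : ℕ → ℝ, (∀ l, B4o ≤ l → (d0zo : ℝ) * (1 / 2 ^ cdo) ≤ d l) → ∀ (N : ℕ) (x : Fin Bo → ℝ),
      ∑ l ∈ Finset.Ico B4o N, (∑ k : Fin Bo, ((gramCoeff a (((k : ℕ) : ℤ) + 1) ((l : ℤ) + 1)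
        - gramCoeff a (((k : ℕ) : ℤ) + 1) (-((l : ℤ) + 1))) / 2) * x k) ^ 2 / d l
        ≤ x ⬝ᵥ (Matrix.of fun k k' : Fin Bo ↦ U2O k k') *ᵥ x)
    {R2o : ℕ} (φo ψo : ℕ → ℕ → ℝ) (dgo : ℕ → ℝ)
    (hfaco : ∀ k < Bo, ∀ k' < Bo, UmO k k' + U2O k k' = (∑ r ∈ Finset.range R2o, φo k r * ψo k' r) + (if k = k' then dgo k else 0))
    (hUsym : ∀ k k', UmO k k' + U2O k k' = UmO k' k + U2O k' k)
    {ρo δo : ℤ} {DSo DSo' Lo : List (List ℤ)}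
    (hSo : SchurNearG (sectorKernel true (gramCoeff a))
      (usubCB (sectorKernel true (gramCoeff a)) φo ψo dgo Bo Ko cvo vo R2o) Bo co ρo DSo true Bo)
    (hDS : ∀ k < Bo, ∀ k' < Bo, PsdDyadic.getMZ DSo' k k' = PsdDyadic.getMZ DSo k k' - if k = k' then lamZ else 0)
    (hPo : PsdDyadic.checkPsdMid Bo δo ρo DSo' Lo = true) :
    2 * ((lamZ : ℝ) * (1 / 2 ^ co)) ≤ weilOddGroundEnergy a := by
  subst hKo hKpo
  set lam : ℝ := (lamZ : ℝ) * (1 / 2 ^ co) with hlam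
  have hSr : (0 : ℝ) < S := by exact_mod_cast hS
  -- ===== ODD numeric facts (far side, against `A + 2·lam`) =====
  have hreBo : MI.mem S (reDigammaQuarter (freq a ((Bo : ℤ) + 1))) (tget ctabO (Bo + 1)).reP := by
    have h := (hCTo (Bo + 1) (by omega) (by omega)).2
    push_cast at h; exact h
  have hreB4o : MI.mem S (reDigammaQuarter (freq a (((Bo + Kpo : ℕ) : ℤ) + 1))) (tget ctabO (Bo + Kpo + 1)).reP := by
    have h := (hCTo (Bo + Kpo + 1) (by omega) (by omega)).2
    push_cast at h ⊢; exact h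
  have hloBo := devOddBox_lo_le_A hS ha hC hF hreBo (by omega) hsqo
  have hloB4o := devOddBox_lo_le_A hS ha hC hF hreB4o (by omega) hsqo
  have h0o' : 0 < devOdd0A a (A + 2 * lam) Bo Bo := by
    have : (0 : ℝ) < (devOddBox S C F (tget ctabO (Bo + 1)) Bo Bo po qo).lo := by exact_mod_cast h0o
    nlinarith
  have hd0o' : (d0zo : ℝ) * (1 / 2 ^ cdo) ≤ devOdd0A a (A + 2 * lam) Bo (Bo + Kpo) := dyadic_le_of_lo hS hd0o hloB4o
  have hd0opos : (0 : ℝ) < (d0zo : ℝ) * (1 / 2 ^ cdo) := by positivity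
  have hwo : ∀ l, Bo ≤ l → l < Bo + Kpo → 0 < wvF vo cvo Bo l ∧ wvF vo cvo Bo l ≤ devOddAA a (A + 2 * lam) Bo l := by
    intro l hl hlK
    obtain ⟨hvpos, hsq, Y, hY, hvle⟩ := weightsOddV_of_check hWo (l - Bo) (by omega)
    rw [show Bo + (l - Bo) = l by omega] at hsq hY
    have hre : MI.mem S (reDigammaQuarter (freq a ((l : ℤ) + 1))) (tget ctabO (l + 1)).reP := by
      have h := (hCTo (l + 1) (by omega) (by omega)).2
      push_cast at h; exact h
    have hlo := devOddABox_lo_le_A hS ha hC hF hre (by omega) hsq hsqo hY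
    have := wv_le_of_lo hS hvpos hvle hlo
    simpa only [wvF] using this
  -- ===== the Schur bands: symmetric completion (DSo is symmetric because DSo' is) =====
  have hDSsym : ∀ i < Bo, ∀ j < Bo, PsdDyadic.getMZ DSo i j = PsdDyadic.getMZ DSo j i := by
    intro i hi j hj
    have h1 := hDS i hi j hj
    have h2 := hDS j hj i hi
    have h3 := getMZ_symm_of_checkPsdMid hPo i hi j hj
    by_cases hij : i = j
    · subst hij; rfl
    · rw [if_neg hij] at h1
      rw [if_neg (Ne.symm hij)] at h2
      linarith
  have hSo' : SchurNearG (sectorKernel true (gramCoeff a))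
      (usubCB (sectorKernel true (gramCoeff a)) φo ψo dgo Bo Ko cvo vo R2o) Bo co ρo DSo false Bo :=
    hSo.of_lower (sectorKernel_gramCoeff_comm true a)
      (fun _ hi _ hj ↦ usubCB_comm _ (fun k k' ↦ UmO k k' + U2O k k') φo ψo dgo Bo Ko cvo R2o vo hfaco hUsym hi hj)
      hDSsym
  -- ===== the door =====
  refine le_weilOddGroundEnergy_of_formatC_oddPiecesA ha hPA lam hBo (Nat.le_add_right Bo Ko)
    (by omega : Bo + Ko ≤ Bo + Kpo) (d0o := (d0zo : ℝ) * (1 / 2 ^ cdo)) (wvF vo cvo Bo) (wvF vo cvo Bo) ?_ ?_ ?_ ?_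
    (Matrix.of fun k k' : Fin Bo ↦ UmO k k') hUmO (Matrix.of fun k k' : Fin Bo ↦ U2O k k') hU2O ?_
  · -- h0o
    have h := h0o'; unfold devOdd0A at h; linarith
  · -- hd0o
    refine ⟨hd0opos, ?_⟩
    have h := hd0o'; unfold devOdd0A at h; push_cast at h ⊢; linarith
  · -- hwo (exact range)
    intro l hl hlK
    have h := hwo l hl (by omega)
    unfold devOddAA at h
    exact ⟨h.1, by linarith [h.2]⟩
  · -- hwmo (middle range)
    intro l hl hlK
    have h := hwo l (by omega) hlK
    unfold devOddAA at h
    exact ⟨h.1, by linarith [h.2]⟩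
  · -- hSo: the shifted Schur matrix is enclosed by `DSo'` with the same radius, and `DSo'` passed the PSD check
    intro x
    have hP := PsdDyadic.psd_of_checkPsdMid hPo (u := 1 / 2 ^ co) (by positivity)
      (fun k k' : Fin Bo ↦ schurEntryG (sectorKernel true (gramCoeff a))
        (usubCB (sectorKernel true (gramCoeff a)) φo ψo dgo Bo Ko cvo vo R2o) k k' - (if (k : ℕ) = k' then lam else 0))
      (fun k k' ↦ by
        have h := hSo' k k.isLt k.isLt k' k'.isLt (fun h ↦ absurd h (by decide))
        have e : (PsdDyadic.getMZ DSo' k k' : ℝ) * (1 / 2 ^ co)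
            = (PsdDyadic.getMZ DSo k k' : ℝ) * (1 / 2 ^ co) - (if (k : ℕ) = k' then lam else 0) := by
          rw [hDS k k.isLt k' k'.isLt]
          push_cast
          by_cases hkk : (k : ℕ) = k'
          · rw [if_pos hkk, if_pos hkk, hlam]; ring
          · rw [if_neg hkk, if_neg hkk]; ring
        rw [e]
        have e2 : schurEntryG (sectorKernel true (gramCoeff a))
              (usubCB (sectorKernel true (gramCoeff a)) φo ψo dgo Bo Ko cvo vo R2o) k k' - (if (k : ℕ) = k' then lam else 0)
            - ((PsdDyadic.getMZ DSo k k' : ℝ) * (1 / 2 ^ co) - (if (k : ℕ) = k' then lam else 0))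
            = schurEntryG (sectorKernel true (gramCoeff a))
              (usubCB (sectorKernel true (gramCoeff a)) φo ψo dgo Bo Ko cvo vo R2o) k k' - (PsdDyadic.getMZ DSo k k' : ℝ) * (1 / 2 ^ co) := by
          ring
        rw [e2]
        exact h) x
    refine le_of_le_of_eq hP (Finset.sum_congr rfl fun k _ ↦ Finset.sum_congr rfl fun k' _ ↦ ?_)
    rw [← odd_entry_eq_schurEntryG a Bo Ko cvo vo (fun k k' ↦ UmO k k' + U2O k k') φo ψo dgo R2o hfaco k k']
    simp only [Matrix.of_apply]
    ring

end Kit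

end Summit.RiemannHypothesis.RiemannHypothesis.Theorems.WeilFormatC

end
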